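import Summits.CriticalPhenomena.CardyFormulaZ2.Theorems.EdgeCoherence.Negative.FalseWithoutInterior

/-!
# `EdgeCoherence` (route `CardyComplexCone`, stmt-CriticalPhenomena-11385) is FALSE without the
# mesh hypothesis `(Λ δ).δ = δ`

Negative lemma for the crux `EdgeCoherence` (cdisprove unit): with the mesh hypothesis dropped the
"family" need not refine — the CONSTANT families `Λ δ := discData (1/3)` and
`Λ δ := discDataSwap (1/3)` of the unit disc are admissible at every `δ`, and `δ → 0⁺` only
rescales `medialPoint δ` (windings are scale invariant) and `meshPoint δ v ∈ K` (the start vertices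
`∓(abCol (1/3), 0)` rescaled by `δ ≤ 1/6` stay in the compact `closedBall 0 (1/2) ⊆ D`).  The rigid
class vectors `(·,0,0,1)` / `(0,1,·,0)` at the two start vertices (file
`CornerObservableRigidity.lean`) are then incompatible with any universal `u`
(`edgeCoherence_false_without_mesh`).  So the crux genuinely needs the lattice to refine: at fixed
mesh the class vector of the corner observable is not projectively universal.
-/

noncomputable section

open MeasureTheory Filter Topology
open Literature.Probability.LatticeModels Literature.Probability.RandomPlanarGeometry
open Literature.Probability.Percolation

namespace Summit.CriticalPhenomena.CardyFormulaZ2.Theorems.EdgeCoherence.Negative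

open Summit.CriticalPhenomena.CardyFormulaZ2.Theses.CardyComplexCone (EdgeCoherence)

/-! ## §3e The mesh hypothesis `(Λ δ).δ = δ` is load-bearing: a non-refining family -/

/-- `EdgeCoherence` with the mesh hypothesis `∀ δ, (Λ δ).δ = δ` DROPPED: the "family" need not refine,
e.g. the CONSTANT family `Λ δ := discData (1/3)` qualifies, and `δ → 0⁺` then only rescales the
picture (`medialPoint δ`, `meshPoint δ v ∈ K`) without changing the combinatorics; as a predicate on `u`. -/
def EdgeCoherenceWithoutMesh (u : Site 2 → ℂ) : Prop :=
  ∀ (D : DobrushinDomain) (Λ : ℝ → DiscreteDobrushin), (∀ δ, (Λ δ).Ω = D.carrier) →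
    (∀ᶠ δ in 𝓝[>] (0:ℝ), (Λ δ).IsZdAdmissible) →
      ∀ K : Set ℂ, IsCompact K → K ⊆ D.carrier → CoherentOn u Λ K

/-- `EdgeCoherenceWithoutMesh` implies the crux. [folklore] -/
theorem edgeCoherence_of_withoutMesh {u : Site 2 → ℂ} (hu : ∃ o : Site 2, IsCorner 0 o ∧ u o ≠ 0)
    (h : EdgeCoherenceWithoutMesh u) : EdgeCoherence := by
  rw [edgeCoherence_iff]
  exact ⟨u, hu, fun D Λ h1 _ h3 K hK hKD => h D Λ h1 h3 K hK hKD⟩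

section ConstantFamily

open UnitDiscDiscretisation

/-- Rescaling mesh points: `meshPoint δ' x = (δ'/δ) · meshPoint δ x`. [folklore] -/
theorem meshPoint_rescale {δ δ' : ℝ} (hδ : δ ≠ 0) (x : Site 2) :
    meshPoint δ' x = ((δ' / δ : ℝ) : ℂ) * meshPoint δ x := by
  have hδc : (δ : ℂ) ≠ 0 := by exact_mod_cast hδ
  simp only [meshPoint, ← mul_assoc]
  congr 1
  push_cast
  rw [div_mul_cancel₀ _ hδc]

/-- For the constant family at data mesh `1/3`, the start vertex rescaled by `δ' ≤ 1/6` lies in the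
closed ball of radius `1/2`. [folklore] -/
theorem norm_meshPoint_rescale_le {δ' : ℝ} (h0 : 0 ≤ δ') (h6 : δ' ≤ 1 / 6) {x : Site 2}
    (hx : ‖meshPoint (1/3 : ℝ) x‖ < 1) : ‖meshPoint δ' x‖ ≤ 1 / 2 := by
  rw [meshPoint_rescale (δ := 1/3) (by norm_num) x, norm_mul, Complex.norm_real, Real.norm_eq_abs,
    abs_of_nonneg (by positivity)]
  have : δ' / (1/3 : ℝ) = 3 * δ' := by ring
  rw [this]
  nlinarith [norm_nonneg (meshPoint (1/3 : ℝ) x)]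

/-- Constant family `discData (1/3)`: rigid value `1` at the start corner, at EVERY scale `δ'`. [folklore] -/
theorem cornerObs_const_discData_start (δ' : ℝ) :
    cornerObs (fun _ => discData (1/3 : ℝ)) δ' ![-(abCol (1/3 : ℝ) : ℤ), 0]
      (faceAt ![-(abCol (1/3 : ℝ) : ℤ), 0] 3) = 1 := by
  have hδ : (0:ℝ) < 1/3 := by norm_num
  have hδ' : (1/3 : ℝ) < 1/2 := by norm_num
  rw [cornerObs_eq]
  have : (fun ω => dartPhaseSum (medialExploration (discData (1/3 : ℝ)) ω) δ'
      ![-(abCol (1/3 : ℝ) : ℤ), 0] (faceAt ![-(abCol (1/3 : ℝ) : ℤ), 0] 3)) = fun _ => (1 : ℂ) := by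
    funext ω
    exact dartPhaseSum_start (isZdAdmissible_discData hδ hδ') (isStartCorner_discData hδ hδ') ω δ'
  simp only [this, integral_const]
  simp

/-- Constant family `discData (1/3)`: rigid zeros on the classes `−e₀`, `−e₀−e₁` at the start vertex. [folklore] -/
theorem cornerObs_const_discData_zero (δ' : ℝ) (kb : Fin 4) (hkb : kb = 1 ∨ kb = 2) :
    cornerObs (fun _ => discData (1/3 : ℝ)) δ' ![-(abCol (1/3 : ℝ) : ℤ), 0]
      (faceAt ![-(abCol (1/3 : ℝ) : ℤ), 0] kb) = 0 := by
  have hδ : (0:ℝ) < 1/3 := by norm_num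
  have hδ' : (1/3 : ℝ) < 1/2 := by norm_num
  rw [cornerObs_eq]
  have : (fun ω => dartPhaseSum (medialExploration (discData (1/3 : ℝ)) ω) δ'
      ![-(abCol (1/3 : ℝ) : ℤ), 0] (faceAt ![-(abCol (1/3 : ℝ) : ℤ), 0] kb)) = fun _ => (0 : ℂ) := by
    funext ω
    refine dartPhaseSum_eq_zero_of_not_isInnerFace (isZdAdmissible_discData hδ hδ')
      (isStartCorner_discData hδ hδ') ω δ' (![-(abCol (1/3 : ℝ) : ℤ), 0], kb) ?_
    rcases hkb with rfl | rfl
    · have : cFace ((![-(abCol (1/3:ℝ) : ℤ), 0] : Site 2), (1 : Fin 4)) = ![-(abCol (1/3:ℝ) : ℤ) - 1, 0] := by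
        funext i; fin_cases i <;> simp [cFace, faceAt, cornerOff]
      rw [this]; exact not_isInnerFace_west hδ hδ'
    · have : cFace ((![-(abCol (1/3:ℝ) : ℤ), 0] : Site 2), (2 : Fin 4)) = ![-(abCol (1/3:ℝ) : ℤ) - 1, -1] := by
        funext i; fin_cases i <;> simp [cFace, faceAt, cornerOff]
      rw [this]; exact not_isInnerFace_gL hδ hδ'
  simp only [this, integral_zero]

/-- Constant swapped family `discDataSwap (1/3)`: rigid value `1` at its start corner, every scale. [folklore] -/
theorem cornerObs_const_discDataSwap_start (δ' : ℝ) :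
    cornerObs (fun _ => discDataSwap (1/3 : ℝ)) δ' ![(abCol (1/3 : ℝ) : ℤ), 0]
      (faceAt ![(abCol (1/3 : ℝ) : ℤ), 0] 1) = 1 := by
  have hδ : (0:ℝ) < 1/3 := by norm_num
  have hδ' : (1/3 : ℝ) < 1/2 := by norm_num
  rw [cornerObs_eq]
  have : (fun ω => dartPhaseSum (medialExploration (discDataSwap (1/3 : ℝ)) ω) δ'
      ![(abCol (1/3 : ℝ) : ℤ), 0] (faceAt ![(abCol (1/3 : ℝ) : ℤ), 0] 1)) = fun _ => (1 : ℂ) := by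
    funext ω
    exact dartPhaseSum_start (isZdAdmissible_discDataSwap hδ hδ') (isStartCorner_discDataSwap hδ hδ') ω δ'
  simp only [this, integral_const]
  simp

/-- Constant swapped family: rigid zeros on the classes `0`, `−e₁` at its start vertex. [folklore] -/
theorem cornerObs_const_discDataSwap_zero (δ' : ℝ) (kb : Fin 4) (hkb : kb = 0 ∨ kb = 3) :
    cornerObs (fun _ => discDataSwap (1/3 : ℝ)) δ' ![(abCol (1/3 : ℝ) : ℤ), 0]
      (faceAt ![(abCol (1/3 : ℝ) : ℤ), 0] kb) = 0 := by
  have hδ : (0:ℝ) < 1/3 := by norm_num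
  have hδ' : (1/3 : ℝ) < 1/2 := by norm_num
  rw [cornerObs_eq]
  have : (fun ω => dartPhaseSum (medialExploration (discDataSwap (1/3 : ℝ)) ω) δ'
      ![(abCol (1/3 : ℝ) : ℤ), 0] (faceAt ![(abCol (1/3 : ℝ) : ℤ), 0] kb)) = fun _ => (0 : ℂ) := by
    funext ω
    refine dartPhaseSum_eq_zero_of_not_isInnerFace (isZdAdmissible_discDataSwap hδ hδ')
      (isStartCorner_discDataSwap hδ hδ') ω δ' (![(abCol (1/3 : ℝ) : ℤ), 0], kb) ?_
    rcases hkb with rfl | rfl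
    · have : cFace ((![(abCol (1/3:ℝ) : ℤ), 0] : Site 2), (0 : Fin 4)) = ![(abCol (1/3:ℝ) : ℤ), 0] := by
        funext i; fin_cases i <;> simp [cFace, faceAt, cornerOff]
      rw [this]; exact fun h => not_isInnerFace_gR hδ hδ' ((isInnerFace_swap _ _).1 h)
    · have : cFace ((![(abCol (1/3:ℝ) : ℤ), 0] : Site 2), (3 : Fin 4)) = ![(abCol (1/3:ℝ) : ℤ), -1] := by
        funext i; fin_cases i <;> simp [cFace, faceAt, cornerOff]
      rw [this]; exact fun h => not_isInnerFace_southEast hδ hδ' ((isInnerFace_swap _ _).1 h)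
  simp only [this, integral_zero]

end ConstantFamily

/-- **THEOREM (load-bearing hypothesis `(Λ δ).δ = δ`).**  With the mesh hypothesis dropped,
`EdgeCoherence` is FALSE: the constant families `Λ δ := discData (1/3)` and `Λ δ := discDataSwap (1/3)`
of the unit disc are admissible at every `δ`, their start vertices `∓(abCol (1/3), 0)` rescaled
by `δ ≤ 1/6` lie in the compact `closedBall 0 (1/2) ⊆ D`, and the class vectors there are the
rigid `(·,0,0,1)` and `(0,1,·,0)` at every scale — incompatible with any universal `u`.  So the
crux genuinely needs the lattice to refine; at fixed mesh the class vector is NOT projectively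
universal (it is pinned near the marked points and, numerically, position dependent in the bulk:
kit job j006179, exact enumeration `n ≤ 5`). [folklore] -/
theorem edgeCoherence_false_without_mesh :
    ¬ ∃ u : Site 2 → ℂ, (∃ o : Site 2, IsCorner 0 o ∧ u o ≠ 0) ∧ EdgeCoherenceWithoutMesh u := by
  rintro ⟨u, ⟨o, ho, huo⟩, h⟩
  have hs := tendsto_one_div_nat_add (show (0:ℝ) < 6 by norm_num)
  have hpos : ∀ n : ℕ, (0:ℝ) ≤ 1 / ((n:ℝ) + 6) := fun n => by positivity
  have hle : ∀ n : ℕ, (1:ℝ) / ((n:ℝ) + 6) ≤ 1 / 6 := fun n =>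
    one_div_le_one_div_of_le (by norm_num) (by linarith [n.cast_nonneg (α := ℝ)])
  have hK : IsCompact (Metric.closedBall (0:ℂ) (1/2)) := isCompact_closedBall _ _
  have hKD : Metric.closedBall (0:ℂ) (1/2) ⊆ DobrushinDomain.unitDisc.carrier := by
    intro z hz
    show z ∈ Metric.ball (0:ℂ) 1
    rw [Metric.mem_ball]; rw [Metric.mem_closedBall] at hz; linarith
  have hδ : (0:ℝ) < 1/3 := by norm_num
  have hδ' : (1/3 : ℝ) < 1/2 := by norm_num
  -- family 1
  have h₁ : CoherentOn u (fun _ => UnitDiscDiscretisation.discData (1/3 : ℝ))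
      (Metric.closedBall (0:ℂ) (1/2)) :=
    h DobrushinDomain.unitDisc _ (fun _ => rfl)
      (Eventually.of_forall fun _ => UnitDiscDiscretisation.isZdAdmissible_discData hδ hδ') _ hK hKD
  have h₂ : CoherentOn u (fun _ => discDataSwap (1/3 : ℝ)) (Metric.closedBall (0:ℂ) (1/2)) :=
    h DobrushinDomain.unitDisc _ (fun _ => rfl)
      (Eventually.of_forall fun _ => isZdAdmissible_discDataSwap hδ hδ') _ hK hKD
  have in₁ : ∀ n : ℕ, meshPoint (1 / ((n:ℝ) + 6))
      (![-(UnitDiscDiscretisation.abCol (1/3 : ℝ) : ℤ), 0] : Site 2) ∈ Metric.closedBall (0:ℂ) (1/2) :=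
    fun n => by
      rw [Metric.mem_closedBall, dist_zero_right]
      exact norm_meshPoint_rescale_le (hpos n) (hle n) (norm_meshPoint_vA_lt_one hδ hδ')
  have in₂ : ∀ n : ℕ, meshPoint (1 / ((n:ℝ) + 6))
      (![(UnitDiscDiscretisation.abCol (1/3 : ℝ) : ℤ), 0] : Site 2) ∈ Metric.closedBall (0:ℂ) (1/2) :=
    fun n => by
      rw [Metric.mem_closedBall, dist_zero_right]
      exact norm_meshPoint_rescale_le (hpos n) (hle n) (norm_meshPoint_xR0_lt_one hδ hδ')
  have k1 : u (-cornerOff 1) = 0 :=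
    u_eq_zero_of_rigid_faceAt h₁ 3 1 _ hs one_pos fun n =>
      ⟨_, in₁ n, by rw [cornerObs_const_discData_start]; simp,
        cornerObs_const_discData_zero _ 1 (Or.inl rfl)⟩
  have k2 : u (-cornerOff 2) = 0 :=
    u_eq_zero_of_rigid_faceAt h₁ 3 2 _ hs one_pos fun n =>
      ⟨_, in₁ n, by rw [cornerObs_const_discData_start]; simp,
        cornerObs_const_discData_zero _ 2 (Or.inr rfl)⟩
  have k0 : u (-cornerOff 0) = 0 :=
    u_eq_zero_of_rigid_faceAt h₂ 1 0 _ hs one_pos fun n =>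
      ⟨_, in₂ n, by rw [cornerObs_const_discDataSwap_start]; simp,
        cornerObs_const_discDataSwap_zero _ 0 (Or.inl rfl)⟩
  have k3 : u (-cornerOff 3) = 0 :=
    u_eq_zero_of_rigid_faceAt h₂ 1 3 _ hs one_pos fun n =>
      ⟨_, in₂ n, by rw [cornerObs_const_discDataSwap_start]; simp,
        cornerObs_const_discDataSwap_zero _ 3 (Or.inr rfl)⟩
  obtain ⟨k, rfl⟩ := exists_eq_neg_cornerOff_of_isCorner ho
  fin_cases k
  · exact huo k0
  · exact huo k1
  · exact huo k2
  · exact huo k3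


end Summit.CriticalPhenomena.CardyFormulaZ2.Theorems.EdgeCoherence.Negative

end
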